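import Literature.AnabelianGeometry.SemiGraphs.CoveringLift

/-!
# The comparison functor `B(𝒢)_{/A} ⥤ B(𝒢_A)` ([SemiAnbd] Def. 2.2 (i), global clause — brick G4(b))

Mochizuki, *Semi-graphs of anabelioids*, Publ. RIMS **42** (2006) 221–322, §2 p. 23
[cite: MochizukiSemiAnbd2006, Def. 2.2(i) p.23]: "`B'` [= `B(𝒢)_{G'}`] itself arises naturally as the
`B(−)` of some semi-graph of anabelioids `𝒢'`".  For the covering `𝒢_A → 𝒢` of `CoveringOfObject.lean`
this file constructs the comparison functor

* `BObj.toCovering A : Over A ⥤ B(𝒢_A)`, `(X → A) ↦ {X_v ×_{S_v} P → P}_{(v,P)}, {X_e ×_{T_e} Q → Q}_{(e,Q)}`,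
  glued along a branch `(b, Q)` at `(v, P)` by the canonical isomorphism
  `b^*(X_v ×_{S_v} P) ×_{b^* P} Q ≅ X_e ×_{T_e} Q` over `Q` — both are the pull-back of
  `X_e → T_e ← Q` (`BObj.isPullback_glue`, using `ψ_b^X : b^* X_v ⥲ X_e`),

via `liftOver` (`CoveringLift.lean`).  That `toCovering A` is an equivalence with
`φ^* ≅ (A × −) ⋙ toCovering A` — the cell's `Hom.IsBObjCoveringOf` — is the proof-only sequel.
-/

namespace Literature.AnabelianGeometry.SemiGraphs

namespace SemiGraphOfAnabelioids

open CategoryTheory CategoryTheory.Limits CategoryTheory.PreGaloisCategory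
open Literature.AnabelianGeometry.Anabelioids

universe w' w v₁ u₁ u

-- Mathlib's `Over.pullback` / `Over.star` simp lemmas (`pullback.lift_fst`, …) only fire under the
-- pre-v4.2x defeq transparency behaviour, exactly as in `Mathlib/CategoryTheory/Comma/Over/Pullback.lean`.
set_option backward.isDefEq.respectTransparency false

namespace BObj

variable {𝒢 : SemiGraphOfAnabelioids.{v₁, u₁, u}} (A : 𝒢.BObj)

/-! ### The comparison functor `Over A ⥤ B(𝒢_A)` -/

/-- The vertex components of the comparison functor: `(X → A) ↦ (X_v ×_{S_v} P → P)`.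
[cite: MochizukiSemiAnbd2006, Def. 2.2(i) p.23] -/
noncomputable def toCoveringV (vc : A.fibreData.total.Vertex) :
    Over A ⥤ Over ((A.vComp vc).1 : 𝒢.V (A.fibreData.proj.vertexMap vc)) :=
  Over.post (𝒢.ρ (A.fibreData.proj.vertexMap vc)) ⋙ Over.pullback (A.vComp vc).1.arrow

/-- The edge components of the comparison functor: `(X → A) ↦ (X_e ×_{T_e} Q → Q)`.
[cite: MochizukiSemiAnbd2006, Def. 2.2(i) p.23] -/
noncomputable def toCoveringE (ec : A.fibreData.total.Edge) :
    Over A ⥤ Over ((A.eComp ec).1 : 𝒢.E (A.fibreData.proj.edgeMap ec)) :=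
  Over.post (𝒢.ρE (A.fibreData.proj.edgeMap ec)) ⋙ Over.pullback (A.eComp ec).1.arrow

/-- The edge component of the comparison functor at the component named by a BRANCH `(b, Q)`, over the
edge of `b` (definitionally `toCoveringE (edgeOf (b, Q))`). [cite: MochizukiSemiAnbd2006, Def. 2.2(i) p.23] -/
noncomputable def toCoveringBr (bc : A.fibreData.total.Branch) :
    Over A ⥤ Over ((A.brComp bc).1 : 𝒢.E (𝒢.graph.edgeOf (A.fibreData.proj.branchMap bc))) :=
  Over.post (𝒢.ρE (𝒢.graph.edgeOf (A.fibreData.proj.branchMap bc))) ⋙ Over.pullback (A.brComp bc).1.arrow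

/-- First projection of `toCoveringV` on morphisms. [cite: MochizukiSemiAnbd2006, Def. 2.2(i) p.23] -/
@[reassoc] theorem toCoveringV_map_left_fst {X Y : Over A} (f : X ⟶ Y) (vc : A.fibreData.total.Vertex) :
    ((A.toCoveringV vc).map f).left ≫ pullback.fst _ _ = pullback.fst _ _ ≫ f.left.fS (A.fibreData.proj.vertexMap vc) := by
  simp [toCoveringV, Over.pullback_map_left]

/-- Second projection of `toCoveringV` on morphisms. [cite: MochizukiSemiAnbd2006, Def. 2.2(i) p.23] -/
@[reassoc] theorem toCoveringV_map_left_snd {X Y : Over A} (f : X ⟶ Y) (vc : A.fibreData.total.Vertex) :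
    ((A.toCoveringV vc).map f).left ≫ pullback.snd _ _ = pullback.snd _ _ := by
  simp [toCoveringV, Over.pullback_map_left]

/-- First projection of `toCoveringE` on morphisms. [cite: MochizukiSemiAnbd2006, Def. 2.2(i) p.23] -/
@[reassoc] theorem toCoveringE_map_left_fst {X Y : Over A} (f : X ⟶ Y) (ec : A.fibreData.total.Edge) :
    ((A.toCoveringE ec).map f).left ≫ pullback.fst _ _ = pullback.fst _ _ ≫ f.left.fT (A.fibreData.proj.edgeMap ec) := by
  simp [toCoveringE, Over.pullback_map_left]

/-- Second projection of `toCoveringE` on morphisms. [cite: MochizukiSemiAnbd2006, Def. 2.2(i) p.23] -/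
@[reassoc] theorem toCoveringE_map_left_snd {X Y : Over A} (f : X ⟶ Y) (ec : A.fibreData.total.Edge) :
    ((A.toCoveringE ec).map f).left ≫ pullback.snd _ _ = pullback.snd _ _ := by
  simp [toCoveringE, Over.pullback_map_left]

/-- First projection of `toCoveringBr` on morphisms. [cite: MochizukiSemiAnbd2006, Def. 2.2(i) p.23] -/
@[reassoc] theorem toCoveringBr_map_left_fst {X Y : Over A} (f : X ⟶ Y) (bc : A.fibreData.total.Branch) :
    ((A.toCoveringBr bc).map f).left ≫ pullback.fst _ _ = pullback.fst _ _ ≫ f.left.fT (𝒢.graph.edgeOf (A.fibreData.proj.branchMap bc)) := by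
  simp [toCoveringBr, Over.pullback_map_left]

/-- Second projection of `toCoveringBr` on morphisms. [cite: MochizukiSemiAnbd2006, Def. 2.2(i) p.23] -/
@[reassoc] theorem toCoveringBr_map_left_snd {X Y : Over A} (f : X ⟶ Y) (bc : A.fibreData.total.Branch) :
    ((A.toCoveringBr bc).map f).left ≫ pullback.snd _ _ = pullback.snd _ _ := by
  simp [toCoveringBr, Over.pullback_map_left]

/-- First projection of the gluing functor on morphisms: `(b^* U ×_{b^*P} Q → b^* U' ×_{b^*P} Q) ≫ pr₁ = pr₁ ≫ b^* u`.
[cite: MochizukiSemiAnbd2006, Def. 2.2(i) p.23] -/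
@[reassoc] theorem gluingAt_map_left_fst {bc : A.fibreData.total.Branch} {vc : A.fibreData.total.Vertex}
    (h : A.fibreData.total.abuts bc = some vc) {U U' : Over ((A.vComp vc).1 : 𝒢.V (A.fibreData.proj.vertexMap vc))}
    (u : U ⟶ U') :
    ((A.gluingAt bc vc h).map u).left ≫ pullback.fst _ _ = pullback.fst _ _ ≫ (𝒢.pull (A.fibreData.proj.branchMap bc) (A.fibreData.proj.vertexMap vc) (abuts_fst h)).pullback.map u.left := by
  simp [gluingAt, Over.pullback_map_left]

/-- Second projection of the gluing functor on morphisms. [cite: MochizukiSemiAnbd2006, Def. 2.2(i) p.23] -/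
@[reassoc] theorem gluingAt_map_left_snd {bc : A.fibreData.total.Branch} {vc : A.fibreData.total.Vertex}
    (h : A.fibreData.total.abuts bc = some vc) {U U' : Over ((A.vComp vc).1 : 𝒢.V (A.fibreData.proj.vertexMap vc))}
    (u : U ⟶ U') :
    ((A.gluingAt bc vc h).map u).left ≫ pullback.snd _ _ = pullback.snd _ _ := by
  simp [gluingAt, Over.pullback_map_left]

/-- **The gluing square**: for `X → A` in `B(𝒢)` and a branch `(b, Q)` of `𝔾_A` at `(v, P)`, the object
`b^*(X_v ×_{S_v} P) ×_{b^* P} Q` is the pull-back of `X_e → T_e ← Q` (via `ψ_b^X : b^* X_v ⥲ X_e`):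
paste `b^*` of the square `X_v ×_{S_v} P` with the square over `Q ↪ b^* P`, and transport along
`ψ_b^X`, `ψ_b^A`. [cite: MochizukiSemiAnbd2006, Def. 2.2(i) p.23] -/
theorem isPullback_glue (X : Over A) (bc : A.fibreData.total.Branch)
    (vc : A.fibreData.total.Vertex) (h : A.fibreData.total.abuts bc = some vc) :
    IsPullback
      ((pullback.fst _ _ : ((A.toCoveringV vc ⋙ A.gluingAt bc vc h).obj X).left ⟶ _) ≫
        (𝒢.pull (A.fibreData.proj.branchMap bc) (A.fibreData.proj.vertexMap vc) (abuts_fst h)).pullback.map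
          (pullback.fst _ _ : ((A.toCoveringV vc).obj X).left ⟶ _) ≫
        (X.left.ψ (A.fibreData.proj.branchMap bc) (A.fibreData.proj.vertexMap vc) (abuts_fst h)).hom)
      (pullback.snd _ _ : ((A.toCoveringV vc ⋙ A.gluingAt bc vc h).obj X).left ⟶ _)
      ((Over.post (𝒢.ρE (𝒢.graph.edgeOf (A.fibreData.proj.branchMap bc)))).obj X).hom
      (A.brComp bc).1.arrow := by
  haveI : PreservesFiniteLimits (𝒢.pull (A.fibreData.proj.branchMap bc) (A.fibreData.proj.vertexMap vc) (abuts_fst h)).pullback :=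
    (𝒢.pull (A.fibreData.proj.branchMap bc) (A.fibreData.proj.vertexMap vc) (abuts_fst h)).property.1
  have sq1 := (𝒢.pull (A.fibreData.proj.branchMap bc) (A.fibreData.proj.vertexMap vc) (abuts_fst h)).pullback.map_isPullback
    (IsPullback.of_hasPullback (X.hom.fS (A.fibreData.proj.vertexMap vc)) (A.vComp vc).1.arrow)
  have sq2 := IsPullback.of_hasPullback
    ((𝒢.pull (A.fibreData.proj.branchMap bc) (A.fibreData.proj.vertexMap vc) (abuts_fst h)).pullback.map (pullback.snd (X.hom.fS (A.fibreData.proj.vertexMap vc)) (A.vComp vc).1.arrow))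
    (A.inclOfLE (abuts_fst h) (A.vComp vc).1 (A.brComp bc).1 (brComp_le_branchImage h))
  have big := sq2.paste_horiz sq1
  refine big.of_iso (Iso.refl _) (X.left.ψ (A.fibreData.proj.branchMap bc) (A.fibreData.proj.vertexMap vc) (abuts_fst h)) (Iso.refl _)
    (A.ψ (A.fibreData.proj.branchMap bc) (A.fibreData.proj.vertexMap vc) (abuts_fst h)) ?_ ?_ ?_ ?_
  · rw [Iso.refl_hom, Category.id_comp, Category.assoc]
    rfl
  · rw [Iso.refl_hom, Iso.refl_hom, Category.id_comp, Category.comp_id]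
    rfl
  · exact X.hom.comm (A.fibreData.proj.branchMap bc) (A.fibreData.proj.vertexMap vc) (abuts_fst h)
  · rw [Iso.refl_hom, Category.id_comp, Category.assoc]
    exact A.inclOfLE_comp _ _ _ _

/-- The gluing isomorphism of the comparison functor at `X → A`: `b^*(X_v ×_{S_v} P) ×_{b^* P} Q ≅ X_e ×_{T_e} Q`
over `Q`. [cite: MochizukiSemiAnbd2006, Def. 2.2(i) p.23] -/
noncomputable def toCoveringGlueApp (bc : A.fibreData.total.Branch) (vc : A.fibreData.total.Vertex)
    (h : A.fibreData.total.abuts bc = some vc) (X : Over A) :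
    (A.toCoveringV vc ⋙ A.gluingAt bc vc h).obj X ≅ (A.toCoveringBr bc).obj X :=
  Over.isoMk (A.isPullback_glue X bc vc h).isoPullback (A.isPullback_glue X bc vc h).isoPullback_hom_snd

/-- First projection of the gluing isomorphism: to `X_e` it is `pr₁ ≫ b^* pr₁ ≫ ψ_b^X`.
[cite: MochizukiSemiAnbd2006, Def. 2.2(i) p.23] -/
@[reassoc] theorem toCoveringGlueApp_hom_left_fst (bc : A.fibreData.total.Branch) (vc : A.fibreData.total.Vertex)
    (h : A.fibreData.total.abuts bc = some vc) (X : Over A) :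
    (A.toCoveringGlueApp bc vc h X).hom.left ≫ pullback.fst _ _ =
      (pullback.fst _ _ : ((A.toCoveringV vc ⋙ A.gluingAt bc vc h).obj X).left ⟶ _) ≫
        (𝒢.pull (A.fibreData.proj.branchMap bc) (A.fibreData.proj.vertexMap vc) (abuts_fst h)).pullback.map
          (pullback.fst _ _ : ((A.toCoveringV vc).obj X).left ⟶ _) ≫
        (X.left.ψ (A.fibreData.proj.branchMap bc) (A.fibreData.proj.vertexMap vc) (abuts_fst h)).hom :=
  (A.isPullback_glue X bc vc h).isoPullback_hom_fst

/-- Second projection of the gluing isomorphism: to `Q` it is `pr₂`.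
[cite: MochizukiSemiAnbd2006, Def. 2.2(i) p.23] -/
@[reassoc] theorem toCoveringGlueApp_hom_left_snd (bc : A.fibreData.total.Branch) (vc : A.fibreData.total.Vertex)
    (h : A.fibreData.total.abuts bc = some vc) (X : Over A) :
    (A.toCoveringGlueApp bc vc h X).hom.left ≫ pullback.snd _ _ =
      (pullback.snd _ _ : ((A.toCoveringV vc ⋙ A.gluingAt bc vc h).obj X).left ⟶ _) :=
  (A.isPullback_glue X bc vc h).isoPullback_hom_snd

/-- Naturality of the gluing isomorphisms in `X → A`.
[cite: MochizukiSemiAnbd2006, Def. 2.2(i) p.23] -/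
theorem toCoveringGlueApp_natural (bc : A.fibreData.total.Branch) (vc : A.fibreData.total.Vertex)
    (h : A.fibreData.total.abuts bc = some vc) {X Y : Over A} (f : X ⟶ Y) :
    (A.toCoveringV vc ⋙ A.gluingAt bc vc h).map f ≫ (A.toCoveringGlueApp bc vc h Y).hom =
      (A.toCoveringGlueApp bc vc h X).hom ≫ (A.toCoveringBr bc).map f := by
  ext
  apply pullback.hom_ext
  · rw [Over.comp_left, Over.comp_left, Category.assoc, Category.assoc, toCoveringGlueApp_hom_left_fst,
      toCoveringBr_map_left_fst, toCoveringGlueApp_hom_left_fst_assoc, Functor.comp_map,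
      gluingAt_map_left_fst_assoc, ← Functor.map_comp_assoc, toCoveringV_map_left_fst,
      Functor.map_comp_assoc]
    erw [f.left.comm (A.fibreData.proj.branchMap bc) (A.fibreData.proj.vertexMap vc) (abuts_fst h)]
  · rw [Over.comp_left, Over.comp_left, Category.assoc, Category.assoc, toCoveringGlueApp_hom_left_snd,
      toCoveringBr_map_left_snd, toCoveringGlueApp_hom_left_snd, Functor.comp_map, gluingAt_map_left_snd]

/-- The gluing isomorphisms of the comparison functor, `b^*(X_v ×_{S_v} P) ×_{b^* P} Q ≅ X_e ×_{T_e} Q`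
over `Q`, naturally in `X → A`. [cite: MochizukiSemiAnbd2006, Def. 2.2(i) p.23] -/
noncomputable def toCoveringGlue (bc : A.fibreData.total.Branch) (vc : A.fibreData.total.Vertex)
    (h : A.fibreData.total.abuts bc = some vc) :
    A.toCoveringV vc ⋙ A.gluingAt bc vc h ≅ A.toCoveringBr bc :=
  NatIso.ofComponents (fun X => A.toCoveringGlueApp bc vc h X)
    (fun f => A.toCoveringGlueApp_natural bc vc h f)

/-- **The comparison functor `B(𝒢)_{/A} ⥤ B(𝒢_A)`** ([SemiAnbd] p. 23, "`B'` … arises as the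
`B(−)` of `𝒢'`"): `(X → A) ↦ {X_v ×_{S_v} P → P, X_e ×_{T_e} Q → Q}` with the canonical gluings.
[cite: MochizukiSemiAnbd2006, Def. 2.2(i) p.23] -/
noncomputable def toCovering : Over A ⥤ A.coveringGraph.BObj :=
  A.liftOver A.toCoveringV A.toCoveringE (fun bc vc h => A.toCoveringGlue bc vc h)

end BObj

end SemiGraphOfAnabelioids

end Literature.AnabelianGeometry.SemiGraphs
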